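import Literature.NumberTheory.Automorphic.JacquetCuspidalCompactCoefficientsCone   -- ★ cone engine with a compact SUBGROUP `K₀`: `apply_mem_span_level_of_conj_mem`, `noncommProd_conj_mem_of_forall`; brings the one-ray engine (`span_level_mono`, `exists_mem_span_level_of_mem_coinvariantsKer`, `apply_pow_apply_eq_zero_of_mem_span_level`, `coinvariantsKer_eq_top_of_subsingleton`)
import HarnessLib

/-!
# Harish-Chandra's support theorem over a cone of contracting directions — the Cartan exhaustion with `k₁, k₂` in a COMPACT SET
# (Bernstein–Zelevinsky 1976 §3.18–3.21; Casselman 1995 Thm. 5.3.1 — any rank, any compact two-sided fudge)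

Topic `NumberTheory/Automorphic`; namespace `Representation` (dot-notation extensions, as in the sibling ★ `JacquetCuspidalCompactCoefficientsCone`).
THEOREMS ONLY: no definition, no named fact, no instance, no notation, no `sorry`.  Cell `hodgecm-mathlib`, Track B «K2-LIT», line K2_E3 (item
`stmt-HodgeConjecture-24833`), road J7 of the 13a letter `sig_K2E3LocalIrrepAdmissible` («irreducible smooth ⇒ admissible» for `U_N(H)(L⁺_v)`, all `N`,
EVERY finite place): the ★ cone engine `Representation.isSupercuspidal_of_subsingleton_coinvariants_of_cartan_pi` asks for the Cartan exhaustion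
`G = K₀ · {∏ a^n} · K₀ · Z(G)` with `K₀` a compact SUBGROUP.  At the places where no good compact open subgroup is in the tree (the non-quasi-split even
unitary groups, Witt type `m = 2`; the wildly ramified quadratic extensions) the structure theory one can supply elementarily is the WEAK Cartan
decomposition `G = Ω · A⁺ · Ω · Z(G)` with `Ω` merely a compact SUBSET (matrix entries bounded by a constant depending on the form).  This file records
that the support theorem needs nothing more: the argument uses `K₀` only through the FINITENESS of the orbits `π(Ω) w` and `π^*(Ω⁻¹) φ` of a smooth
vector and a smooth linear form, which holds for every compact set `Ω` (finitely many open cosets of the stabiliser cover `Ω`).  HONEST SCOPE: no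
structure theory is supplied here (the cone, the contraction data and the weak Cartan exhaustion are hypotheses); HC_CM is proved only modulo its
printed citations until rung 0 closes.

THE MATHEMATICS ([Casselman1995, Thm. 5.3.1]; [BernsteinZelevinsky1976, 3.18–3.21] for `GL_n`), verbatim as in the sibling with `K₀ ↦ Ω`: `π` SMOOTH;
finitely many directions `α`, each with a subgroup `N_α` along which `π` is Jacquet-cuspidal, a level filtration `(N_{α,j})_j` (increasing, exhausting,
shrinking to `1`) contracted by `a_α`; a DOMINANT set `M` of level-preserving elements; a COMPACT SET `Ω ⊆ G` with `G = Ω · M · Ω · Z(G)`; DEPTH of the cone.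
For `k₁, k₂ ∈ Ω`, `m ∈ M`, `z` central: `φ(π(k₁ aⁿ m k₂ z) w) = (π^*(k₁⁻¹) φ)(π(aⁿ)(π(m)(π(z)(π(k₂) w))))`; the vectors `π(k₂) w` (`k₂ ∈ Ω`) and the forms
`π^*(k₁⁻¹) φ` (`k₁⁻¹ ∈ Ω⁻¹`, compact) are FINITELY MANY, each `π(k₂) w` lies in one level span of `N_α`, preserved by `π(z)` and `π(m)` and contracted by
`π(a_α)ⁿ` into the (open) stabiliser of the form — so the coefficient vanishes for `n ≥ n₀(α)`, uniformly; the monomials of the cone with all exponents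
`< Σ n₀` are finitely many, whence `supp ⊆ Ω · F · Ω · Z(G)`, compact times the centre: `π.IsSupercuspidal`.

* §1 `finite_orbit_of_isSmoothVector_of_isCompact` (the orbit of a smooth vector under a compact SET is finite);
  `exists_forall_apply_conj_pow_mul_apply_eq_zero_of_isCompact` (uniform vanishing at `k₁ aⁿ m k₂ z`, `k₁, k₂ ∈ Ω`).
* §2 **`isSupercuspidal_of_coinvariantsKer_eq_top_of_cartan_cone_set`** (abstract dominant set `M`, compact set `Ω`) and its parabolic-triple packaging
  **`isSupercuspidal_of_subsingleton_coinvariants_of_cartan_cone_set`**.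
* §3 the CONE instance **`isSupercuspidal_of_subsingleton_coinvariants_of_cartan_pi_set`**: pairwise commuting `a : ι → G`, `G = Ω · {∏_α a_α^{n_α}} · Ω · Z(G)`
  with `Ω` a compact SET — the shape the weak Cartan decomposition of `U(σ, wittFormOn e Han)(K)` supplies at every non-split place; and the remark
  `isSupercuspidal_of_subsingleton_coinvariants_of_cartan_pi_of_subset` that a subgroup exhaustion inside a compact set is a special case.

## References
* [Casselman1995] W. Casselman, *Introduction to the theory of admissible representations of `p`-adic reductive groups* (draft 1 May 1995), §2.1 p. 20
  («the smoothness of `π` implies that this is essentially a finite sum»), Prop. 1.4.3, Thm. 5.3.1.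
* [BernsteinZelevinsky1976] I. N. Bernstein, A. V. Zelevinsky, *Representations of the group `GL(n, F)` where `F` is a non-archimedean local field*,
  Russian Math. Surveys 31:3 (1976) 1–68: §3.18–3.21.
* [HarishChandra1970] Harish-Chandra (notes by G. van Dijk), *Harmonic analysis on reductive `p`-adic groups*, LNM 162 (1970): Part I §3.
* [BruhatTits1972] F. Bruhat, J. Tits, *Groupes réductifs sur un corps local I*, Publ. Math. IHÉS 41 (1972), (4.4.3) (`G = K A⁺ K` for a good `K`; any
  compact open `K′` gives `G = Ω A⁺ Ω` with `Ω = ⋃ x_i K′` a finite union of cosets).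
-/

set_option autoImplicit false

noncomputable section

open scoped Pointwise Function

namespace Representation

open Literature.NumberTheory.Automorphic Literature.NumberTheory.Automorphic.JacquetLemma

section Topological

variable {k G V : Type*} [Field k] [Group G] [TopologicalSpace G] [IsTopologicalGroup G]
  [AddCommGroup V] [Module k V] (π : Representation k G V)

/-! ## §1 Finite orbits under a compact set; the uniform vanishing -/

/-- **Finite orbits under a compact SET.** If `w` is a smooth vector (open stabiliser) and `Ω ⊆ G` is compact, the set `{π(g) w : g ∈ Ω}` is finite:
finitely many open cosets `c · Stab(w)` cover `Ω`, and `π(g) w = π(c) w` on `c · Stab(w)` — the compact-set form of ★ `finite_orbit_of_isSmoothVector`.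
[cite: Casselman1995, §2.1, p. 20] -/
theorem finite_orbit_of_isSmoothVector_of_isCompact {Ω : Set G} (hΩ : IsCompact Ω) {w : V} (hw : π.IsSmoothVector w) :
    ((fun g : G => π g w) '' Ω).Finite := by
  have hUo : ∀ c : G, IsOpen ((fun g : G => c⁻¹ * g) ⁻¹' (π.stabilizerSubgroup w : Set G)) :=
    fun c => hw.preimage (continuous_const_mul c⁻¹)
  have hcov : Ω ⊆ ⋃ c : G, (fun g : G => c⁻¹ * g) ⁻¹' (π.stabilizerSubgroup w : Set G) := by
    intro x _
    refine Set.mem_iUnion.2 ⟨x, ?_⟩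
    show x⁻¹ * x ∈ (π.stabilizerSubgroup w : Set G)
    rw [inv_mul_cancel]
    exact (π.stabilizerSubgroup w).one_mem
  obtain ⟨s, hs⟩ := hΩ.elim_finite_subcover _ hUo hcov
  refine (s.finite_toSet.image fun c : G => π c w).subset ?_
  rintro _ ⟨h, hh, rfl⟩
  obtain ⟨c, hc, hcU⟩ := Set.mem_iUnion₂.1 (hs hh)
  have hfix : π (c⁻¹ * h) w = w := hcU
  refine ⟨c, Finset.mem_coe.2 hc, ?_⟩
  calc π c w = π c (π (c⁻¹ * h) w) := by rw [hfix]
    _ = π h w := by rw [← Module.End.mul_apply, ← map_mul, mul_inv_cancel_left]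

omit [TopologicalSpace G] [IsTopologicalGroup G] in
/-- `φ (π(g) y) = (π^*(g⁻¹) φ) y`. [folklore] -/
private theorem apply_apply_eq_dual_apply_of_inv'' (φ : Module.Dual k V) (g : G) (y : V) :
    φ (π g y) = π.dual g⁻¹ φ y := by
  rw [dual_apply, inv_inv, Module.Dual.transpose_apply, LinearMap.comp_apply]

/-- **Uniform vanishing behind a dominant element, compact-set form** [BZ76 3.19; Casselman Thm. 5.3.1]: `π` smooth and Jacquet-cuspidal along `N`,
`(N_j)` increasing, exhausting `N`, shrinking to `1`, contracted by `a` and PRESERVED by every element of `M`; `Ω` a compact SET.  Then for a smooth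
linear form `φ` and any `w` there is `n₀` with `φ (π(k₁ · aⁿ m · k₂ z) w) = 0` for all `k₁, k₂ ∈ Ω`, `m ∈ M`, central `z`, `n ≥ n₀`: the orbits `π(Ω) w`
and `π^*(Ω⁻¹) φ` are finite (§1, `Ω⁻¹` is compact), `π(m)`, `π(z)` preserve the level of `π(k₂) w`, and `aⁿ` contracts that level into the stabiliser of
`π^*(k₁⁻¹) φ` (★ `apply_pow_apply_eq_zero_of_mem_span_level`). [cite: Casselman1995, Thm. 5.3.1] [cite: BernsteinZelevinsky1976, §3.18–3.21] -/
theorem exists_forall_apply_conj_pow_mul_apply_eq_zero_of_isCompact (hπ : π.IsSmooth) (N : Subgroup G)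
    (hker : Coinvariants.ker (π.comp N.subtype) = ⊤)
    (Nf : ℤ → Subgroup G) (hmono : ∀ j : ℤ, Nf j ≤ Nf (j + 1)) (hexh : ∀ u ∈ N, ∃ j : ℤ, u ∈ Nf j)
    (hsmall : ∀ U ∈ nhds (1 : G), ∃ j : ℤ, (Nf j : Set G) ⊆ U)
    (a : G) (hcontr : ∀ j : ℤ, ∀ u ∈ Nf (j + 1), a * u * a⁻¹ ∈ Nf j)
    (M : Set G) (hdom : ∀ m ∈ M, ∀ j : ℤ, ∀ u ∈ Nf j, m * u * m⁻¹ ∈ Nf j)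
    {Ω : Set G} (hΩ : IsCompact Ω)
    {φ : Module.Dual k V} (hφ : φ ∈ π.contragredient) (w : V) :
    ∃ n₀ : ℕ, ∀ n : ℕ, n₀ ≤ n → ∀ k₁ ∈ Ω, ∀ m ∈ M, ∀ k₂ ∈ Ω, ∀ z ∈ Subgroup.center G,
      φ (π (k₁ * (a ^ n * m) * k₂ * z) w) = 0 := by
  set Oφ : Set (Module.Dual k V) := (fun g : G => π.dual g φ) '' Ω⁻¹ with hOφ
  set Ow : Set V := (fun g : G => π g w) '' Ω with hOw
  have hOφf : Oφ.Finite := π.dual.finite_orbit_of_isSmoothVector_of_isCompact hΩ.inv hφ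
  have hOwf : Ow.Finite := π.finite_orbit_of_isSmoothVector_of_isCompact hΩ (hπ w)
  -- the one-coefficient bound for every pair in the product of the orbits (vacuous bound outside)
  have hpair : ∀ x : Module.Dual k V × V, ∃ n₀ : ℕ, x ∈ Oφ ×ˢ Ow →
      ∀ n : ℕ, n₀ ≤ n → ∀ m ∈ M, ∀ z ∈ Subgroup.center G, x.1 (π (a ^ n) (π m (π z x.2))) = 0 := by
    rintro ⟨φ', w'⟩
    by_cases hx : (φ', w') ∈ Oφ ×ˢ Ow
    · obtain ⟨⟨g, -, rfl⟩, -⟩ := hx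
      have hφ' : π.dual g φ ∈ π.contragredient := π.contragredient.apply_mem_toSubmodule g hφ
      obtain ⟨j₀, hj₀⟩ := hsmall _ (((π.mem_contragredient _).1 hφ').mem_nhds (Subgroup.one_mem _))
      have hw' : w' ∈ Coinvariants.ker (π.comp N.subtype) := by rw [hker]; trivial
      obtain ⟨J, hJ⟩ := π.exists_mem_span_level_of_mem_coinvariantsKer N Nf hmono hexh hw'
      refine ⟨(J - j₀).toNat, fun _ n hn m hm z hz => ?_⟩
      refine π.apply_pow_apply_eq_zero_of_mem_span_level Nf hmono a hcontr hj₀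
        (π.apply_mem_span_level_of_conj_mem Nf J (hdom m hm J)
          (π.apply_mem_span_level_of_comm Nf J (fun u _ => ((Subgroup.mem_center_iff.1 hz) u).symm) hJ)) n (by omega)
    · exact ⟨0, fun h => absurd h hx⟩
  choose n₀ hn₀ using hpair
  refine ⟨(hOφf.prod hOwf).toFinset.sum n₀, fun n hn k₁ hk₁ m hm k₂ hk₂ z hz => ?_⟩
  have hmem : (π.dual k₁⁻¹ φ, π k₂ w) ∈ Oφ ×ˢ Ow := ⟨⟨k₁⁻¹, Set.inv_mem_inv.2 hk₁, rfl⟩, ⟨k₂, hk₂, rfl⟩⟩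
  have hle : n₀ (π.dual k₁⁻¹ φ, π k₂ w) ≤ (hOφf.prod hOwf).toFinset.sum n₀ :=
    Finset.single_le_sum (f := n₀) (fun _ _ => Nat.zero_le _) ((Set.Finite.mem_toFinset _).2 hmem)
  have hkz : k₂ * z = z * k₂ := (Subgroup.mem_center_iff.1 hz) k₂
  rw [mul_assoc (k₁ * (a ^ n * m)) k₂ z, hkz, map_mul, map_mul, map_mul, map_mul, Module.End.mul_apply, Module.End.mul_apply,
    Module.End.mul_apply, Module.End.mul_apply, apply_apply_eq_dual_apply_of_inv'']
  exact hn₀ _ hmem n (hle.trans hn) m hm z hz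

/-! ## §2 Compact support modulo the centre from a weak Cartan exhaustion over a dominant set -/

/-- **HARISH-CHANDRA'S SUPPORT THEOREM OVER A DOMINANT CONE, compact-set form** [Casselman 1995 Thm. 5.3.1, any rank; BZ76 3.21].  `π` SMOOTH; finitely
many directions `α`, each with a subgroup `N α` along which `π` is Jacquet-cuspidal (`V = V(N α)`), a level filtration `Nf α` (increasing, exhausting,
shrinking to `1`) and a contracting element `a α`; a DOMINANT set `M` (each `m ∈ M` preserves every `Nf α j`); a compact SET `Ω` with the weak Cartan
exhaustion `G = Ω · M · Ω · Z(G)`; and DEPTH: for each `n₀`, every `m ∈ M` lies in a compact exceptional set `F` or is `m = (a α)^n m'` with `n ≥ n₀`,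
`m' ∈ M` for some `α`.  Then the smooth matrix coefficients of `π` are supported in `Ω F Ω · Z(G)`: `π.IsSupercuspidal`.
[cite: Casselman1995, Thm. 5.3.1] [cite: BernsteinZelevinsky1976, §3.18–3.21] [cite: HarishChandra1970, Part I §3] -/
theorem isSupercuspidal_of_coinvariantsKer_eq_top_of_cartan_cone_set (hπ : π.IsSmooth) {ι : Type*} [Finite ι]
    (N : ι → Subgroup G) (hker : ∀ α, Coinvariants.ker (π.comp (N α).subtype) = ⊤)
    (Nf : ι → ℤ → Subgroup G) (hmono : ∀ α (j : ℤ), Nf α j ≤ Nf α (j + 1)) (hexh : ∀ α, ∀ u ∈ N α, ∃ j : ℤ, u ∈ Nf α j)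
    (hsmall : ∀ α, ∀ U ∈ nhds (1 : G), ∃ j : ℤ, (Nf α j : Set G) ⊆ U)
    (a : ι → G) (hcontr : ∀ α (j : ℤ), ∀ u ∈ Nf α (j + 1), a α * u * (a α)⁻¹ ∈ Nf α j)
    (M : Set G) (hdom : ∀ m ∈ M, ∀ α (j : ℤ), ∀ u ∈ Nf α j, m * u * m⁻¹ ∈ Nf α j)
    (Ω : Set G) (hΩ : IsCompact Ω)
    (hcartan : ∀ g : G, ∃ k₁ ∈ Ω, ∃ m ∈ M, ∃ k₂ ∈ Ω, ∃ z ∈ Subgroup.center G, g = k₁ * m * k₂ * z)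
    (hdeep : ∀ n₀ : ℕ, ∃ F : Set G, IsCompact F ∧
      ∀ m ∈ M, m ∈ F ∨ ∃ α, ∃ n : ℕ, n₀ ≤ n ∧ ∃ m' ∈ M, m = a α ^ n * m') :
    π.IsSupercuspidal := by
  haveI := Fintype.ofFinite ι
  intro φ hφ w
  -- a uniform depth `n₀` beyond which the coefficient vanishes, in every direction
  have hdir : ∀ α, ∃ n₀ : ℕ, ∀ n : ℕ, n₀ ≤ n → ∀ k₁ ∈ Ω, ∀ m ∈ M, ∀ k₂ ∈ Ω, ∀ z ∈ Subgroup.center G,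
      φ (π (k₁ * (a α ^ n * m) * k₂ * z) w) = 0 := fun α =>
    π.exists_forall_apply_conj_pow_mul_apply_eq_zero_of_isCompact hπ (N α) (hker α) (Nf α) (hmono α) (hexh α) (hsmall α) (a α)
      (hcontr α) M (fun m hm j u hu => hdom m hm α j u hu) hΩ hφ w
  choose n₀ hn₀ using hdir
  obtain ⟨F, hF, hFM⟩ := hdeep (Finset.univ.sum n₀)
  refine ⟨Ω * F * Ω, (hΩ.mul hF).mul hΩ, fun g hg => ?_⟩
  rw [Function.mem_support, matrixCoeff_apply] at hg
  obtain ⟨k₁, hk₁, m, hm, k₂, hk₂, z, hz, rfl⟩ := hcartan g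
  rcases hFM m hm with hmF | ⟨α, n, hn, m', hm', rfl⟩
  · exact Set.mem_mul.2 ⟨k₁ * m * k₂, Set.mul_mem_mul (Set.mul_mem_mul hk₁ hmF) hk₂, z, hz, rfl⟩
  · exact absurd (hn₀ α n ((Finset.single_le_sum (f := n₀) (fun _ _ => Nat.zero_le _) (Finset.mem_univ α)).trans hn)
      k₁ hk₁ m' hm' k₂ hk₂ z hz) hg

/-- **The same, in the parabolic-triple currency of ★ `JacquetModule`**: vanishing Jacquet modules `Subsingleton (t_α.restrict π).Coinvariants` along
finitely many triples `t α`, contraction data along each `(t α).N`, a dominant set with a weak Cartan exhaustion through a compact SET `Ω` and depth ⇒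
`π.IsSupercuspidal`. [cite: Casselman1995, Thm. 5.3.1] [cite: BernsteinZelevinsky1976, §3.18–3.21] -/
theorem isSupercuspidal_of_subsingleton_coinvariants_of_cartan_cone_set (hπ : π.IsSmooth) {ι : Type*} [Finite ι]
    (t : ι → ParabolicTriple G) (hJ : ∀ α, Subsingleton ((t α).restrict π).Coinvariants)
    (Nf : ι → ℤ → Subgroup G) (hmono : ∀ α (j : ℤ), Nf α j ≤ Nf α (j + 1)) (hexh : ∀ α, ∀ u ∈ (t α).N, ∃ j : ℤ, u ∈ Nf α j)
    (hsmall : ∀ α, ∀ U ∈ nhds (1 : G), ∃ j : ℤ, (Nf α j : Set G) ⊆ U)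
    (a : ι → G) (hcontr : ∀ α (j : ℤ), ∀ u ∈ Nf α (j + 1), a α * u * (a α)⁻¹ ∈ Nf α j)
    (M : Set G) (hdom : ∀ m ∈ M, ∀ α (j : ℤ), ∀ u ∈ Nf α j, m * u * m⁻¹ ∈ Nf α j)
    (Ω : Set G) (hΩ : IsCompact Ω)
    (hcartan : ∀ g : G, ∃ k₁ ∈ Ω, ∃ m ∈ M, ∃ k₂ ∈ Ω, ∃ z ∈ Subgroup.center G, g = k₁ * m * k₂ * z)
    (hdeep : ∀ n₀ : ℕ, ∃ F : Set G, IsCompact F ∧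
      ∀ m ∈ M, m ∈ F ∨ ∃ α, ∃ n : ℕ, n₀ ≤ n ∧ ∃ m' ∈ M, m = a α ^ n * m') :
    π.IsSupercuspidal :=
  π.isSupercuspidal_of_coinvariantsKer_eq_top_of_cartan_cone_set hπ (fun α => (t α).N)
    (fun α => by haveI := hJ α; exact π.coinvariantsKer_eq_top_of_subsingleton (t α)) Nf hmono hexh hsmall a hcontr M hdom Ω hΩ
    hcartan hdeep

/-! ## §3 The cone of monomials `∏_α a_α^{n_α}` with a compact-set fudge -/

/-- **HARISH-CHANDRA'S SUPPORT THEOREM OVER THE CONE `{∏_α a_α^{n_α}}`, WEAK CARTAN FORM** (Casselman Thm. 5.3.1, any rank): `π` smooth with vanishing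
Jacquet modules along the triples `t α` (`α ∈ ι` finite), contraction data `(Nf α, a α)` with the `a β` pairwise COMMUTING and each `a β` preserving every
level `Nf α j`, a compact SET `Ω` and the weak Cartan exhaustion `G = Ω · {∏_α a_α^{n_α} : n ∈ ℕ^ι} · Ω · Z(G)` (the product in any fixed order,
`Finset.noncommProd`).  Then `π.IsSupercuspidal`.  (For the unitary groups `U(σ, wittFormOn e Han)(K)` of Witt index `r` at ANY non-split place:
`ι = Fin r`, `a_i` the Witt cocharacters at a uniformiser, `Ω` = the elements with matrix entries bounded by a constant of the form.)
[cite: Casselman1995, Thm. 5.3.1] [cite: BernsteinZelevinsky1976, §3.18–3.21] [cite: HarishChandra1970, Part I §3] -/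
theorem isSupercuspidal_of_subsingleton_coinvariants_of_cartan_pi_set (hπ : π.IsSmooth) {ι : Type*} [Fintype ι] [DecidableEq ι]
    (t : ι → ParabolicTriple G) (hJ : ∀ α, Subsingleton ((t α).restrict π).Coinvariants)
    (Nf : ι → ℤ → Subgroup G) (hmono : ∀ α (j : ℤ), Nf α j ≤ Nf α (j + 1)) (hexh : ∀ α, ∀ u ∈ (t α).N, ∃ j : ℤ, u ∈ Nf α j)
    (hsmall : ∀ α, ∀ U ∈ nhds (1 : G), ∃ j : ℤ, (Nf α j : Set G) ⊆ U)
    (a : ι → G) (hcomm : ∀ α β, Commute (a α) (a β))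
    (hcontr : ∀ α (j : ℤ), ∀ u ∈ Nf α (j + 1), a α * u * (a α)⁻¹ ∈ Nf α j)
    (hpres : ∀ α β (j : ℤ), ∀ u ∈ Nf α j, a β * u * (a β)⁻¹ ∈ Nf α j)
    (Ω : Set G) (hΩ : IsCompact Ω)
    (hcartan : ∀ g : G, ∃ k₁ ∈ Ω, ∃ k₂ ∈ Ω, ∃ n : ι → ℕ, ∃ z ∈ Subgroup.center G,
      g = k₁ * Finset.univ.noncommProd (fun α => a α ^ n α) (fun α _ β _ _ => (hcomm α β).pow_pow (n α) (n β)) * k₂ * z) :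
    π.IsSupercuspidal := by
  -- the dominant set: all monomials
  let mono : (ι → ℕ) → G := fun n => Finset.univ.noncommProd (fun α => a α ^ n α) (fun α _ β _ _ => (hcomm α β).pow_pow (n α) (n β))
  let M : Set G := Set.range mono
  have hdom : ∀ m ∈ M, ∀ α (j : ℤ), ∀ u ∈ Nf α j, m * u * m⁻¹ ∈ Nf α j := by
    rintro _ ⟨n, rfl⟩ α j u hu
    refine noncommProd_conj_mem_of_forall Finset.univ _ _ (Nf α j) (fun β _ v hv => ?_) u hu
    -- `a β ^ n β` preserves `Nf α j`
    induction n β with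
    | zero => simpa using hv
    | succ c ih =>
      have h := hpres α β j _ ih
      rwa [show a β * (a β ^ c * v * (a β ^ c)⁻¹) * (a β)⁻¹ = a β ^ (c + 1) * v * (a β ^ (c + 1))⁻¹ by rw [pow_succ']; group] at h
  refine π.isSupercuspidal_of_subsingleton_coinvariants_of_cartan_cone_set hπ t hJ Nf hmono hexh hsmall a hcontr M hdom Ω hΩ
    (fun g => ?_) (fun n₀ => ?_)
  · obtain ⟨k₁, hk₁, k₂, hk₂, n, z, hz, rfl⟩ := hcartan g
    exact ⟨k₁, hk₁, mono n, ⟨n, rfl⟩, k₂, hk₂, z, hz, rfl⟩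
  · -- exceptional set: the monomials with all exponents `< n₀` (finitely many)
    have hfin : {n : ι → ℕ | ∀ α, n α < n₀}.Finite := by
      refine (Set.Finite.pi fun _ : ι => Set.finite_Iio n₀).subset fun n hn => ?_
      exact Set.mem_univ_pi.2 fun α => hn α
    refine ⟨mono '' {n | ∀ α, n α < n₀}, (hfin.image _).isCompact, ?_⟩
    rintro _ ⟨n, rfl⟩
    by_cases h : ∀ α, n α < n₀
    · exact Or.inl ⟨n, h, rfl⟩
    · push Not at h
      obtain ⟨α, hα⟩ := h
      refine Or.inr ⟨α, n α, hα, mono (Function.update n α 0), ⟨_, rfl⟩, ?_⟩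
      -- peel the `α`-th factor off the monomial
      have h1 := Finset.mul_noncommProd_erase Finset.univ (Finset.mem_univ α) (fun β => a β ^ n β)
        (fun β _ γ _ _ => (hcomm β γ).pow_pow (n β) (n γ))
      have h2 := Finset.mul_noncommProd_erase Finset.univ (Finset.mem_univ α) (fun β => a β ^ Function.update n α 0 β)
        (fun β _ γ _ _ => (hcomm β γ).pow_pow (Function.update n α 0 β) (Function.update n α 0 γ))
      have h3 : (Finset.univ.erase α).noncommProd (fun β => a β ^ Function.update n α 0 β)
            (fun β hβ γ hγ hne => (hcomm β γ).pow_pow (Function.update n α 0 β) (Function.update n α 0 γ)) =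
          (Finset.univ.erase α).noncommProd (fun β => a β ^ n β) (fun β hβ γ hγ hne => (hcomm β γ).pow_pow (n β) (n γ)) :=
        Finset.noncommProd_congr rfl (fun β hβ => by rw [Function.update_of_ne (Finset.ne_of_mem_erase hβ)]) _
      show mono n = a α ^ n α * mono (Function.update n α 0)
      simp only [mono]
      rw [← h1, ← h2, h3, Function.update_self, pow_zero, one_mul]

/-- **A subgroup exhaustion inside a compact set is a weak Cartan exhaustion**: the ★ hypothesis shape of
`isSupercuspidal_of_subsingleton_coinvariants_of_cartan_pi` (`k₁, k₂ ∈ K₀ ≤ G`, `K₀` compact) is the special case `Ω = K₀` of the compact-set form.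
[cite: Casselman1995, Thm. 5.3.1] [cite: BruhatTits1972, (4.4.3)] -/
theorem isSupercuspidal_of_subsingleton_coinvariants_of_cartan_pi_of_subset (hπ : π.IsSmooth) {ι : Type*} [Fintype ι] [DecidableEq ι]
    (t : ι → ParabolicTriple G) (hJ : ∀ α, Subsingleton ((t α).restrict π).Coinvariants)
    (Nf : ι → ℤ → Subgroup G) (hmono : ∀ α (j : ℤ), Nf α j ≤ Nf α (j + 1)) (hexh : ∀ α, ∀ u ∈ (t α).N, ∃ j : ℤ, u ∈ Nf α j)
    (hsmall : ∀ α, ∀ U ∈ nhds (1 : G), ∃ j : ℤ, (Nf α j : Set G) ⊆ U)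
    (a : ι → G) (hcomm : ∀ α β, Commute (a α) (a β))
    (hcontr : ∀ α (j : ℤ), ∀ u ∈ Nf α (j + 1), a α * u * (a α)⁻¹ ∈ Nf α j)
    (hpres : ∀ α β (j : ℤ), ∀ u ∈ Nf α j, a β * u * (a β)⁻¹ ∈ Nf α j)
    (K₀ : Set G) {C : Set G} (hC : IsCompact C) (hK₀C : K₀ ⊆ C)
    (hcartan : ∀ g : G, ∃ k₁ ∈ K₀, ∃ k₂ ∈ K₀, ∃ n : ι → ℕ, ∃ z ∈ Subgroup.center G,
      g = k₁ * Finset.univ.noncommProd (fun α => a α ^ n α) (fun α _ β _ _ => (hcomm α β).pow_pow (n α) (n β)) * k₂ * z) :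
    π.IsSupercuspidal :=
  π.isSupercuspidal_of_subsingleton_coinvariants_of_cartan_pi_set hπ t hJ Nf hmono hexh hsmall a hcomm hcontr hpres C hC fun g => by
    obtain ⟨k₁, hk₁, k₂, hk₂, n, z, hz, rfl⟩ := hcartan g
    exact ⟨k₁, hK₀C hk₁, k₂, hK₀C hk₂, n, z, hz, rfl⟩

end Topological

end Representation

end
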